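import Mathlib
import Summits.ValiantsHypothesis.ValiantsHypothesis.Theses.ValuativeGCT
import Summits.ValiantsHypothesis.ValiantsHypothesis.Theorems.ValuativeGCTCutBitesHwExtraction
import Summits.ValiantsHypothesis.ValiantsHypothesis.Theorems.ValuativeGCTCutBites

/-!
# `ValuativeGCT.ValuativeFlip` (stmt-ValiantsHypothesis-12624), det census — HIGHEST-WEIGHT EXTRACTION AT ANY
# VANISHING ORDER, AND THE CUT CRITERION FOR JETS

Wall-breaker axis "det-orbit-closure multiplicity bounds for the det census".  The tree's extraction engine
`CutBitesAdjugate.stub_hwExtraction` turns a `Stab_End(det_m)`-invariant form NOT VANISHING at a point of `L_U` into a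
`B`-semi-invariant with the same property (order `0`).  For thresholds beyond the first rung the census needs the same
at every vanishing ORDER: an invariant form outside `I(L_U)^t` yields a `B`-semi-invariant of some weight `λ*` outside
`I(L_U)^t`, hence a strict drop `finrank T_U(t, λ*) < finrank T_U(0, λ*)` — the extraction half of the jet census of line
`skew-restriction-rank` (whose rank–nullity half `stub_jetRankNullity` is landed).

* `hwExtraction_notMem_pow` — order-`t` extraction: `G` homogeneous of degree `D`, `Stab`-invariant, `G ∉ I(L_U)^t` ⟹
  `∃ λ ⊢ D (≤ m² parts)` and a `Stab`-invariant `B`-semi-invariant `G'` of weight `(dualOfPartition (m·m) λ).toMatIdx`,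
  homogeneous of degree `D`, with `G' ∉ I(L_U)^t`.  Same mechanism as the order-`0` case (complete reducibility of the
  rational `GL(MatIdx m)`-module `Hom_D ⊓ Stab`, Lie–Kolchin, dominance, torus weights), the stable submodule being now
  `Hom_D ⊓ Stab ⊓ I(L_U)^t`: the left action maps `I(L_U)` into itself (`L_U` is left-stable) hence `I(L_U)^t` into itself
  (`Ideal.map_pow`).
* `finrank_trunc_lt_of_notMem_pow` — cut criterion for jets: one element of `T_U(0, χ)` outside `I(L_U)^t` forces
  `finrank T_U(t, χ) < finrank T_U(0, χ)` (over the crux's four-factor `let`-shape).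

References: R. Goodman, N. Wallach, *Symmetry, Representations, and Invariants* (2009) §3.3, §4.2.5; BLMW 2011 §5.2.
-/

namespace Summit.ValiantsHypothesis.ValiantsHypothesis.Theorems.ValuativeFlip

open Literature.NumberTheory.DiophantineGeometry Literature.Computability.AlgebraicComplexity
open MvPolynomial
open scoped BigOperators Matrix
open CutBitesAdjugate

-- `Summit.ValiantsHypothesis.ValiantsHypothesis.…` is the tree's mandated single-conjunct layout (Sub = Summit).
set_option linter.dupNamespace false

/-- **Order-`t` highest-weight extraction.**  An `H`-invariant form `G` of degree `D` on `End(ℂ^{m×m})`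
(`H = Stab_End(det_m)` acting by the crux's row action) lying OUTSIDE `I(L_U)^t` yields `λ ⊢ D` (`≤ m²` parts) and an
`H`-invariant `B`-semi-invariant form `G'` of degree `D` and weight `(dualOfPartition (m·m) λ).toMatIdx`, again outside
`I(L_U)^t`.  (`t = 1`: the order-`0` engine `CutBitesAdjugate.stub_hwExtraction`.) [folklore; Goodman–Wallach §3.3] -/
theorem hwExtraction_notMem_pow (m D t : ℕ) (U : Submodule ℂ (MatIdx m → ℂ)) (G : MvPolynomial (MatIdx m × MatIdx m) ℂ)
    (hGh : G.IsHomogeneous D)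
    (hGs : ∀ M : Matrix (MatIdx m) (MatIdx m) ℂ, linSubst (MatIdx m) ℂ M (detFormLex ℂ m) = detFormLex ℂ m →
      MvPolynomial.aeval (fun p : MatIdx m × MatIdx m =>
        ∑ l : MatIdx m, M l p.2 • (X (p.1, l) : MvPolynomial (MatIdx m × MatIdx m) ℂ)) G = G)
    (hGt : G ∉ MvPolynomial.vanishingIdeal ℂ {q : MatIdx m × MatIdx m → ℂ |
        ∀ j : MatIdx m, (fun i => q (j, i)) ∈ U} ^ t) :
    ∃ lam : Nat.Partition D, lam.parts.card ≤ m * m ∧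
      ∃ G' : MvPolynomial (MatIdx m × MatIdx m) ℂ, G'.IsHomogeneous D ∧
        (∀ M : Matrix (MatIdx m) (MatIdx m) ℂ, linSubst (MatIdx m) ℂ M (detFormLex ℂ m) = detFormLex ℂ m →
          MvPolynomial.aeval (fun p : MatIdx m × MatIdx m =>
            ∑ l : MatIdx m, M l p.2 • (X (p.1, l) : MvPolynomial (MatIdx m × MatIdx m) ℂ)) G' = G') ∧
        (∀ g : Matrix.GeneralLinearGroup (MatIdx m) ℂ, IsUpperTriangular g →
          MvPolynomial.aeval (fun p : MatIdx m × MatIdx m =>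
            ∑ l : MatIdx m, ((g⁻¹ : Matrix.GeneralLinearGroup (MatIdx m) ℂ) : Matrix (MatIdx m) (MatIdx m) ℂ) p.1 l •
              (X (l, p.2) : MvPolynomial (MatIdx m × MatIdx m) ℂ)) G'
            = weightChar (Weight.dualOfPartition (m * m) lam).toMatIdx g • G') ∧
        G' ∉ MvPolynomial.vanishingIdeal ℂ {q : MatIdx m × MatIdx m → ℂ |
          ∀ j : MatIdx m, (fun i => q (j, i)) ∈ U} ^ t := by
  -- adapted from `CutBitesAdjugate.stub_hwExtraction` (the order-`0` case `t = 1`), same mechanism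
  classical
  set Stab : Submodule ℂ (MvPolynomial (MatIdx m × MatIdx m) ℂ) :=
    ⨅ (M : Matrix (MatIdx m) (MatIdx m) ℂ)
      (_ : linSubst (MatIdx m) ℂ M (detFormLex ℂ m) = detFormLex ℂ m),
      LinearMap.ker ((MvPolynomial.aeval (R := ℂ) fun p : MatIdx m × MatIdx m =>
        ∑ l : MatIdx m, M l p.2 • (X (p.1, l) : MvPolynomial (MatIdx m × MatIdx m) ℂ)).toLinearMap
        - LinearMap.id (R := ℂ) (M := MvPolynomial (MatIdx m × MatIdx m) ℂ)) with hStabdef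
  have hmemStab : ∀ F : MvPolynomial (MatIdx m × MatIdx m) ℂ, F ∈ Stab ↔
      ∀ M : Matrix (MatIdx m) (MatIdx m) ℂ, linSubst (MatIdx m) ℂ M (detFormLex ℂ m) = detFormLex ℂ m →
        MvPolynomial.aeval (R := ℂ) (fun p : MatIdx m × MatIdx m =>
          ∑ l : MatIdx m, M l p.2 • (X (p.1, l) : MvPolynomial (MatIdx m × MatIdx m) ℂ)) F = F := by
    intro F
    simp only [hStabdef, Submodule.mem_iInf, LinearMap.mem_ker, LinearMap.sub_apply, sub_eq_zero,
      AlgHom.toLinearMap_apply, LinearMap.id_coe, id_eq]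
  set V : Submodule ℂ (MvPolynomial (MatIdx m × MatIdx m) ℂ) :=
    MvPolynomial.homogeneousSubmodule (MatIdx m × MatIdx m) ℂ D ⊓ Stab with hVdef
  haveI : Module.Finite ℂ ↥(MvPolynomial.homogeneousSubmodule (MatIdx m × MatIdx m) ℂ D) :=
    Module.Finite.iff_fg.mpr (MvPolynomial.homogeneousSubmodule_fg _ ℂ _)
  haveI : FiniteDimensional ℂ ↥V := Submodule.finiteDimensional_of_le (inf_le_left : V ≤ _)
  have hVstab : ∀ (B : Matrix (MatIdx m) (MatIdx m) ℂ), ∀ F ∈ V,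
      MvPolynomial.aeval (R := ℂ) (fun q : MatIdx m × MatIdx m =>
        ∑ l : MatIdx m, B q.1 l • (X (l, q.2) : MvPolynomial (MatIdx m × MatIdx m) ℂ)) F ∈ V := by
    intro B F hF
    obtain ⟨hFh, hFs⟩ := Submodule.mem_inf.mp hF
    refine Submodule.mem_inf.mpr ⟨?_, ?_⟩
    · exact (mem_homogeneousSubmodule _ _).mpr
        (hwx_leftAct_isHomogeneous B ((mem_homogeneousSubmodule _ _).mp hFh))
    · rw [hmemStab] at hFs ⊢
      intro M hM
      rw [← hwx_leftAct_rightAct_comm, hFs M hM]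
  let ρ : Representation ℂ (GL (MatIdx m) ℂ) ↥V :=
    { toFun := fun g => (MvPolynomial.aeval (R := ℂ) (fun q : MatIdx m × MatIdx m =>
          ∑ l : MatIdx m, ((g⁻¹ : GL (MatIdx m) ℂ) : Matrix (MatIdx m) (MatIdx m) ℂ) q.1 l •
            (X (l, q.2) : MvPolynomial (MatIdx m × MatIdx m) ℂ))).toLinearMap.restrict (hVstab _)
      map_one' := LinearMap.ext fun v => Subtype.ext (by
        simp only [LinearMap.coe_restrict_apply, AlgHom.toLinearMap_apply, Module.End.one_apply, inv_one,
          Units.val_one, hwx_leftAct_one])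
      map_mul' := fun g h => LinearMap.ext fun v => Subtype.ext (by
        simp only [LinearMap.coe_restrict_apply, AlgHom.toLinearMap_apply, Module.End.mul_apply,
          hwx_leftAct_leftAct, mul_inv_rev, Units.val_mul]) }
  have hρv : ∀ (g : GL (MatIdx m) ℂ) (v : ↥V), ((ρ g v : ↥V) : MvPolynomial (MatIdx m × MatIdx m) ℂ)
      = MvPolynomial.aeval (R := ℂ) (fun q : MatIdx m × MatIdx m =>
          ∑ l : MatIdx m, ((g⁻¹ : GL (MatIdx m) ℂ) : Matrix (MatIdx m) (MatIdx m) ℂ) q.1 l •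
            (X (l, q.2) : MvPolynomial (MatIdx m × MatIdx m) ℂ)) (v : MvPolynomial (MatIdx m × MatIdx m) ℂ) :=
    fun g v => rfl
  have hρrat : IsRationalRep ρ := by
    refine isRationalRep_of_forall_exists_eval_inv fun v φ => ?_
    obtain ⟨ψ, hψ⟩ := LinearMap.exists_extend φ
    obtain ⟨Q, hQ⟩ := hwx_exists_eval_eq_apply_leftAct (v : MvPolynomial (MatIdx m × MatIdx m) ℂ) ψ
    refine ⟨Q, fun g => ?_⟩
    rw [← hQ ((g⁻¹ : GL (MatIdx m) ℂ) : Matrix (MatIdx m) (MatIdx m) ℂ), ← hρv, ← hψ]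
    rfl
  set L : Set (MatIdx m × MatIdx m → ℂ) := {q | ∀ j : MatIdx m, (fun i => q (j, i)) ∈ U} with hLdef
  let N : Submodule ℂ ↥V := (((MvPolynomial.vanishingIdeal ℂ L) ^ t).restrictScalars ℂ).comap V.subtype
  have hmemN : ∀ v : ↥V, v ∈ N ↔
      (v : MvPolynomial (MatIdx m × MatIdx m) ℂ) ∈ (MvPolynomial.vanishingIdeal ℂ L) ^ t := by
    intro v
    simp only [N, Submodule.mem_comap, Submodule.restrictScalars_mem, Submodule.subtype_apply]
  -- the left action maps `I(L_U)` into itself (`L_U` is left-stable), hence `I(L_U)^t` into itself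
  have hmapI : ∀ (B : Matrix (MatIdx m) (MatIdx m) ℂ),
      Ideal.map (MvPolynomial.aeval (R := ℂ) (fun q : MatIdx m × MatIdx m =>
        ∑ l : MatIdx m, B q.1 l • (X (l, q.2) : MvPolynomial (MatIdx m × MatIdx m) ℂ)))
        (MvPolynomial.vanishingIdeal ℂ L) ≤ MvPolynomial.vanishingIdeal ℂ L := by
    intro B
    refine Ideal.map_le_iff_le_comap.mpr fun F hF => ?_
    rw [Ideal.mem_comap, mem_vanishingIdeal_iff]
    intro q hq
    rw [mem_vanishingIdeal_iff] at hF
    have h := hF (fun q' : MatIdx m × MatIdx m => ∑ l : MatIdx m, B q'.1 l * q (l, q'.2))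
      (fun j => hwx_rows_mem_of_rows_mem U B hq j)
    change MvPolynomial.eval _ F = 0 at h
    change MvPolynomial.eval q (MvPolynomial.aeval _ F) = 0
    rwa [hwx_eval_leftAct]
  have hpowstab : ∀ (B : Matrix (MatIdx m) (MatIdx m) ℂ) (F : MvPolynomial (MatIdx m × MatIdx m) ℂ),
      F ∈ (MvPolynomial.vanishingIdeal ℂ L) ^ t →
      MvPolynomial.aeval (R := ℂ) (fun q : MatIdx m × MatIdx m =>
        ∑ l : MatIdx m, B q.1 l • (X (l, q.2) : MvPolynomial (MatIdx m × MatIdx m) ℂ)) F ∈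
        (MvPolynomial.vanishingIdeal ℂ L) ^ t := by
    intro B F hF
    have h1 := Ideal.mem_map_of_mem (MvPolynomial.aeval (R := ℂ) (fun q : MatIdx m × MatIdx m =>
        ∑ l : MatIdx m, B q.1 l • (X (l, q.2) : MvPolynomial (MatIdx m × MatIdx m) ℂ))) hF
    rw [Ideal.map_pow] at h1
    exact Ideal.pow_right_mono (hmapI B) t h1
  have hNstab : ∀ (g : GL (MatIdx m) ℂ), ∀ v ∈ N, ρ g v ∈ N := by
    intro g v hv
    rw [hmemN] at hv ⊢
    rw [hρv]
    exact hpowstab _ _ hv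
  have hGV : G ∈ V := Submodule.mem_inf.mpr ⟨(mem_homogeneousSubmodule _ _).mpr hGh, (hmemStab G).mpr hGs⟩
  have hNtop : N ≠ ⊤ := by
    intro h
    have hGN : (⟨G, hGV⟩ : ↥V) ∈ N := h ▸ Submodule.mem_top
    exact hGt ((hmemN _).mp hGN)
  obtain ⟨χ, v, hv, hvN⟩ := hwx_exists_mem_highestWeightSpace_not_mem ρ hρrat N hNstab hNtop
  have hv0 : v ≠ 0 := fun h => hvN (h ▸ N.zero_mem)
  have hG'h : (v : MvPolynomial (MatIdx m × MatIdx m) ℂ).IsHomogeneous D :=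
    (mem_homogeneousSubmodule _ _).mp (Submodule.mem_inf.mp v.2).1
  have hG's := (hmemStab _).mp (Submodule.mem_inf.mp v.2).2
  have hG'w : ∀ g : GL (MatIdx m) ℂ, IsUpperTriangular g →
      MvPolynomial.aeval (R := ℂ) (fun q : MatIdx m × MatIdx m =>
        ∑ l : MatIdx m, ((g⁻¹ : GL (MatIdx m) ℂ) : Matrix (MatIdx m) (MatIdx m) ℂ) q.1 l •
          (X (l, q.2) : MvPolynomial (MatIdx m × MatIdx m) ℂ)) (v : MvPolynomial (MatIdx m × MatIdx m) ℂ)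
        = weightChar χ g • (v : MvPolynomial (MatIdx m × MatIdx m) ℂ) := by
    intro g hg
    rw [← hρv, hv g hg, Submodule.coe_smul]
  have hG'0 : (v : MvPolynomial (MatIdx m × MatIdx m) ℂ) ≠ 0 := fun h =>
    hv0 (Subtype.ext (h.trans (Submodule.coe_zero (p := V)).symm))
  have hvt : (v : MvPolynomial (MatIdx m × MatIdx m) ℂ) ∉ (MvPolynomial.vanishingIdeal ℂ L) ^ t :=
    fun h => hvN ((hmemN v).mpr h)
  have hdom : χ.IsDominant := isDominant_of_mem_highestWeightSpace hρrat hv hv0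
  obtain ⟨s, hs⟩ := MvPolynomial.ne_zero_iff.mp hG'0
  have hχ : χ = fun i => -((∑ q ∈ s.support with q.1 = i, s q : ℕ) : ℤ) :=
    hwx_weight_eq_neg_rowDegrees (fun t ht => hG'w t ht.isUpperTriangular) hs
  have hdeg : (∑ q ∈ s.support, s q) = D := by
    have := hG'h (mem_support_iff.mp (mem_support_iff.mpr hs))
    simpa [Finsupp.weight_apply, Finsupp.sum] using this
  have hnonpos : ∀ i, χ i ≤ 0 := fun i => by rw [hχ]; simp only [Left.neg_nonpos_iff]; positivity
  have hsize : χ.size = -((1 * D : ℕ) : ℤ) := by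
    rw [Weight.size, hχ, one_mul, ← hdeg]
    simp only [Finset.sum_neg_distrib]
    rw [← Nat.cast_sum, Finset.sum_fiberwise_of_maps_to (g := Prod.fst) (fun q _ => Finset.mem_univ q.1)]
  obtain ⟨lam, hlamN, hlam⟩ :=
    Weight.exists_eq_dualOfPartition_comp_of_nonpos (matIdxEquiv m) χ hnonpos hdom hsize
  refine ⟨⟨lam.parts, lam.parts_pos, by rw [lam.parts_sum, mul_one]⟩, hlamN,
    (v : MvPolynomial (MatIdx m × MatIdx m) ℂ), hG'h, hG's, fun g hg => ?_, hvt⟩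
  have hχ' : (Weight.dualOfPartition (m * m)
      (⟨lam.parts, lam.parts_pos, by rw [lam.parts_sum, mul_one]⟩ : Nat.Partition D)).toMatIdx = χ := by
    rw [hlam]
    rfl
  rw [hχ', hG'w g hg]


/-- **Cut criterion for jets.**  One element of the census space `Hom ⊓ I^0 ⊓ S₁ ⊓ S₂` (`I^0 = ⊤`) lying outside `I^t`
forces `finrank (Hom ⊓ I^t ⊓ S₁ ⊓ S₂) < finrank (Hom ⊓ I^0 ⊓ S₁ ⊓ S₂)`, for `Hom` finite-dimensional. [folklore] -/
theorem finrank_trunc_lt_of_notMem_pow {σ : Type*} {Hom S₁ S₂ : Submodule ℂ (MvPolynomial σ ℂ)} [Module.Finite ℂ ↥Hom]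
    {I : Ideal (MvPolynomial σ ℂ)} {t : ℕ} {G : MvPolynomial σ ℂ}
    (hG : G ∈ Hom ⊓ (I ^ 0).restrictScalars ℂ ⊓ S₁ ⊓ S₂) (hGt : G ∉ I ^ t) :
    Module.finrank ℂ ↥(Hom ⊓ (I ^ t).restrictScalars ℂ ⊓ S₁ ⊓ S₂)
      < Module.finrank ℂ ↥(Hom ⊓ (I ^ 0).restrictScalars ℂ ⊓ S₁ ⊓ S₂) := by
  have hle : Hom ⊓ (I ^ 0).restrictScalars ℂ ⊓ S₁ ⊓ S₂ ≤ Hom :=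
    inf_le_left.trans (inf_le_left.trans inf_le_left)
  haveI : FiniteDimensional ℂ ↥(Hom ⊓ (I ^ 0).restrictScalars ℂ ⊓ S₁ ⊓ S₂) :=
    Submodule.finiteDimensional_of_le hle
  have hsub : Hom ⊓ (I ^ t).restrictScalars ℂ ⊓ S₁ ⊓ S₂ ≤ Hom ⊓ (I ^ 0).restrictScalars ℂ ⊓ S₁ ⊓ S₂ :=
    inf_le_inf_right _ (inf_le_inf_right _ (inf_le_inf_left _
      (Submodule.restrictScalars_mono ℂ (Ideal.pow_le_pow_right (Nat.zero_le t)))))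
  refine Submodule.finrank_lt_finrank_of_lt (lt_of_le_of_ne hsub fun h => hGt ?_)
  have hG' : G ∈ Hom ⊓ (I ^ t).restrictScalars ℂ ⊓ S₁ ⊓ S₂ := by rw [h]; exact hG
  exact (Submodule.mem_inf.mp (Submodule.mem_inf.mp (Submodule.mem_inf.mp hG').1).1).2

end Summit.ValiantsHypothesis.ValiantsHypothesis.Theorems.ValuativeFlip
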